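import Summits.BirchSwinnertonDyer.Rank1Residual.Additive.QuadraticTwistTypeG
import Literature.NumberTheory.EllipticCurves.SelmerCorankControlRatProofs
import Literature.NumberTheory.EllipticCurves.ArtinFormalismSemistableLocalProofs
import Literature.NumberTheory.EllipticCurves.HasseWeilGoodReductionFrobenius
import Literature.NumberTheory.EllipticCurves.LFunctionSmulProofs
import Literature.NumberTheory.Automorphic.SolvableBaseChangeModularityProofs
import HarnessLib

/-!
# Additive classes X3/X4, defect 2: a good ORDINARY twist by `p*` gives Delbourgo's (G)-ordinary, hence X3♯(G-ord)/X4♯(G-ord)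

HONEST FRAMING (cell `b2b-bsdres`, run/shared/lean/b2b/bsd-rank1-residual/, verbatim in every
file): the goal of the cell is to DELETE the COMBINATION-SHAPED residual classes of the
Birch–Swinnerton-Dyer formula for ALL analytic-rank `≤ 1` elliptic curves over `ℚ` — "full BSD
formula for every rank `≤ 1` curve in class `C`" assembled STRICTLY from published theorems — so
that the rank-`≤ 1` remainder becomes exactly the CONSTRUCTION-SHAPED classes, which are TYPED
(missing-input `Prop`s), NOT attempted. This is not "finishing BSD". Sub-cell `additive-p2`
(X3/X4, potentially good ordinary half): research route; no claim beyond the stated classes.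

Theorems only. Completes the kernel DICTIONARY for the semistability-defect-2 case (Kodaira `I₀*`;
all sub-class pairs at `p = 3`, 681 of the 1280 census pairs of X3♯(G-ord) ∪ X4♯(G-ord)): if a
globally minimal model `Wd` of the quadratic twist `E^{(p*)}` (`p* = (−1)^{⌊p/2⌋} p`, `p` odd) is
GOOD ORDINARY at `p` (`GoodOrd Wd p`: `p ∤ N(E^{(p*)})`, `p ∤ a_p(E^{(p*)})` — the census bit), then
`E` is of Delbourgo type (G) with ORDINARY reduction above `p` (`TypeGOrd W p`), so
`ClassX3 W p → ClassX3Gord W p` and `ClassX4 W p → ClassX4Gord W p`. Ingredients beyond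
`QuadraticTwistTypeG.lean`: the unit-root condition `HasUnitRootAt` is (i) `p ∤ a_w` with `a_w` the
local trace of Frobenius (`frobeniusTraceAt`, by definition), (ii) invariant under `F`-isomorphism
at a place of good reduction (tree `WeierstrassCurve.frobeniusTraceAt_smul`, via `localPolynomial_smul`:
the local Euler factor is an isomorphism invariant), and (iii) preserved from `ℚ` to `F` above `p`: `a_w = D_f(a_p, p) ≡ a_p^f (mod p)`
(`localPolynomialAt_baseChange_of_hasGoodReductionAt`, Silverman AEC V.2.3.1, and the congruence
`D_n(t, δ) ≡ t^n (mod δ)` for the Dickson polynomial, `dvd_dickson_one_eval_sub_pow`).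

References: D. Delbourgo, Compositio Math. 113 (1998) §1.5 (G), Thm. 3; J. H. Silverman, AEC
V.2.3.1, VII.5.4, X.2; R. Greenberg, LNM 1716 (1999) Thm. 1.2 (the unit-root hypothesis).
-/

noncomputable section

open scoped Classical NumberField

open Polynomial WeierstrassCurve IsDedekindDomain IsDedekindDomain.HeightOneSpectrum NumberField
  Rat.HeightOneSpectrum Literature.NumberTheory.EllipticCurves
  Literature.NumberTheory.EllipticCurves.Rank1Residual

namespace Summit.BirchSwinnertonDyer.Rank1Residual.Additive

universe u

/-! ### The Dickson congruence `D_n(t, δ) ≡ tⁿ (mod δ)` -/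

/-- `δ ∣ D_{n+1}(t, δ) − t^{n+1}` for the Dickson polynomial of the first kind
(`D_{m+2} = t·D_{m+1} − δ·D_m`, `D_1 = t`, `D_2 = t² − 2δ`): the power sums `αⁿ + βⁿ` of the
Frobenius eigenvalues are `≡ (α + β)ⁿ` modulo `αβ`. -/
theorem dvd_dickson_one_eval_sub_pow (t δ : ℤ) (n : ℕ) :
    δ ∣ (dickson 1 δ (n + 1)).eval t - t ^ (n + 1) := by
  induction n using Nat.twoStepInduction with
  | zero => simp [dickson_one]
  | one =>
    refine ⟨-2, ?_⟩
    simp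
    ring
  | more n ih1 ih2 =>
    obtain ⟨a, ha⟩ := ih1
    obtain ⟨b, hb⟩ := ih2
    refine ⟨t * b - δ * a - t ^ (n + 1), ?_⟩
    have h := dickson_add_two (k := 1) (a := δ) (n + 1)
    rw [show n + 1 + 2 = n + 2 + 1 by ring] at h
    rw [h, eval_sub, eval_mul, eval_X, eval_mul, eval_C]
    have ha' : (dickson 1 δ (n + 1)).eval t = t ^ (n + 1) + δ * a := by linarith
    have hb' : (dickson 1 δ (n + 1 + 1)).eval t = t ^ (n + 1 + 1) + δ * b := by linarith
    rw [ha', show n + 2 = n + 1 + 1 by ring, hb']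
    ring

/-! ### The unit-root condition: by definition, under isomorphism, under base change -/

section UnitRoot

variable {K : Type u} [Field K] [NumberField K]

/-- `HasUnitRootAt` is `char(k_v) ∤ a_v` with `a_v = W.frobeniusTraceAt v` (both are the integer
`#k_v + 1 − #Ẽ_v(k_v)` of the chosen local minimal model; definitional). -/
theorem hasUnitRootAt_iff_not_dvd_frobeniusTraceAt (V : WeierstrassCurve K)
    (v : HeightOneSpectrum (𝓞 K)) :
    V.HasUnitRootAt v ↔
      ¬ ((ringChar (IsLocalRing.ResidueField (v.adicCompletionIntegers K)) : ℤ) ∣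
        V.frobeniusTraceAt v) :=
  Iff.rfl

/-- **The unit-root condition is an isomorphism invariant at a place of good reduction.** -/
theorem hasUnitRootAt_smul_iff (V : WeierstrassCurve K) [V.IsElliptic] (C : VariableChange K)
    (v : HeightOneSpectrum (𝓞 K)) (hV : V.HasGoodReductionAt v) :
    (C • V).HasUnitRootAt v ↔ V.HasUnitRootAt v := by
  rw [hasUnitRootAt_iff_not_dvd_frobeniusTraceAt, hasUnitRootAt_iff_not_dvd_frobeniusTraceAt,
    WeierstrassCurve.frobeniusTraceAt_smul V C v hV]

variable (V : WeierstrassCurve ℚ) [V.IsElliptic] (M : Type) [Field M] [NumberField M]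
  (p : ℕ) [hp : Fact p.Prime]

/-- **Good ORDINARY reduction at `p` over `ℚ` stays ordinary above `p` in any finite extension**
(any ramification): if `V/ℚ` is good at the place `v ∋ p` with `p ∤ a_v`, then for every place
`w ∣ v` of `M`, `V_M` satisfies the unit-root condition at `w`, because
`a_w = D_f(a_v, q_v) ≡ a_v^f (mod p)` (`q_v = #k_v ≡ 0 mod p`). -/
theorem hasUnitRootAt_baseChange_of_hasGoodReductionAt {v : HeightOneSpectrum (𝓞 ℚ)}
    {w : HeightOneSpectrum (𝓞 M)} (hpv : (p : 𝓞 ℚ) ∈ v.asIdeal)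
    (hw : w.asIdeal.under (𝓞 ℚ) = v.asIdeal) (hgood : V.HasGoodReductionAt v)
    (hord : V.HasUnitRootAt v) : (V.baseChange M).HasUnitRootAt w := by
  -- residue characteristics
  have hpw : (p : 𝓞 M) ∈ w.asIdeal := by
    have : (p : 𝓞 ℚ) ∈ w.asIdeal.under (𝓞 ℚ) := by rw [hw]; exact hpv
    rw [Ideal.under_def, Ideal.mem_comap, map_natCast] at this
    exact this
  have hcv : ringChar (IsLocalRing.ResidueField (v.adicCompletionIntegers ℚ)) = p :=
    ringChar_residueField_eq v hp.out hpv
  have hcw : ringChar (IsLocalRing.ResidueField (w.adicCompletionIntegers M)) = p :=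
    ringChar_residueField_eq w hp.out hpw
  have hqv : (p : ℤ) ∣ (Nat.card (IsLocalRing.ResidueField (v.adicCompletionIntegers ℚ)) : ℤ) := by
    rw [← hcv]
    exact Int.natCast_dvd_natCast.mpr (ringChar_residueField_dvd_natCard v)
  -- the local polynomial upstairs
  haveI : w.asIdeal.LiesOver v.asIdeal := ⟨hw.symm⟩
  have hgoodw : (V.baseChange M).HasGoodReductionAt w :=
    hasGoodReductionAt_baseChange_of_hasGoodReductionAt V M v w hgood
  have hup := V.localPolynomialAt_baseChange_of_hasGoodReductionAt M hw hgood
    (localPolynomialAt_of_hasGoodReductionAt hgood)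
  rw [localPolynomialAt_of_hasGoodReductionAt hgoodw] at hup
  have haw := eq_of_one_sub_C_mul_X_add_eq hup
  -- `f ≥ 1`
  have hf : 0 < w.asIdeal.inertiaDeg (𝓞 ℚ) := by
    haveI : w.asIdeal.IsMaximal := w.isMaximal
    exact Ideal.inertiaDeg_pos w.asIdeal (𝓞 ℚ)
  obtain ⟨f, hf'⟩ : ∃ f, w.asIdeal.inertiaDeg (𝓞 ℚ) = f + 1 := ⟨_, (Nat.succ_pred_eq_of_pos hf).symm⟩
  -- conclude: `p ∣ a_w ↔ p ∣ a_v`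
  rw [hasUnitRootAt_iff_not_dvd_frobeniusTraceAt, hcw, haw, hf']
  rw [hasUnitRootAt_iff_not_dvd_frobeniusTraceAt, hcv] at hord
  intro hdvd
  have hD := dvd_dickson_one_eval_sub_pow (V.frobeniusTraceAt v)
    (Nat.card (IsLocalRing.ResidueField (v.adicCompletionIntegers ℚ)) : ℤ) f
  have hpow : (p : ℤ) ∣ V.frobeniusTraceAt v ^ (f + 1) := by
    have := dvd_sub hdvd (dvd_trans hqv hD)
    simpa using this
  exact hord (Int.Prime.dvd_pow' hp.out hpow)

end UnitRoot

/-! ### From a good ordinary twist by `p*` to (G)-ordinary and the sub-classes -/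

section Twist

variable (W : WeierstrassCurve ℚ) [W.IsElliptic] (p : ℕ) [hp : Fact p.Prime]

/-- **Good ORDINARY twist by `p*` ⇒ (G)-ordinary.** Let `p` be odd and `Wd` a globally minimal model
of the quadratic twist `E^{(p*)}` (`C₀ • W^{(p*)} = Wd` over `ℚ`, `p* = (−1)^{⌊p/2⌋} p`). If `Wd` is
good ordinary at `p` (`GoodOrd Wd p`: good reduction and `p ∤ a_p`), then `E` has good ORDINARY
reduction above `p` over `F = ℚ(√p*) ⊆ ℚ(ζ_p)`: `TypeGOrd W p`. -/
theorem typeGOrd_of_goodOrd_quadraticTwist (hp2 : p ≠ 2) (Wd : WeierstrassCurve ℚ)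
    [Wd.IsElliptic] [Wd.IsGloballyMinimal] (C₀ : VariableChange ℚ)
    (hWd : C₀ • W.quadraticTwist ((-1 : ℚ) ^ (p / 2) * p) = Wd) (hord : GoodOrd Wd p) :
    TypeGOrd W p := by
  haveI hcyc : IsCyclotomicExtension {p} ℚ (CyclotomicField p ℚ) := by
    have h : (CyclotomicField.algebra p ℚ : Algebra ℚ (CyclotomicField p ℚ)) =
        DivisionRing.toRatAlgebra :=
      Subsingleton.elim _ _
    exact h ▸ CyclotomicField.isCyclotomicExtension p ℚ
  obtain ⟨g, hg⟩ := exists_sq_eq_pStar p (CyclotomicField p ℚ) hp2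
  set F : IntermediateField ℚ (CyclotomicField p ℚ) := IntermediateField.adjoin ℚ {g} with hFdef
  refine ⟨CyclotomicField p ℚ, inferInstance, inferInstance, hcyc, F, fun w hw ↦ ?_⟩
  set d : ℚ := (-1 : ℚ) ^ (p / 2) * p with hd
  set v : HeightOneSpectrum (𝓞 ℚ) := (primesEquiv (R := 𝓞 ℚ)).symm ⟨p, hp.out⟩ with hvdef
  have hpv : (p : 𝓞 ℚ) ∈ v.asIdeal :=
    (natCast_mem_asIdeal_iff_eq_primesEquiv_symm v hp.out).mpr rfl
  have hwv : w.asIdeal.under (𝓞 ℚ) = v.asIdeal := under_eq_asIdeal_of_natCast_mem p w hw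
  haveI : w.asIdeal.LiesOver v.asIdeal := ⟨hwv.symm⟩
  -- `Wd` good ordinary at `v`, hence `Wd_F` good with unit root at `w`
  obtain ⟨hgv, huv⟩ := Wd.hasGoodReductionAt_and_hasUnitRootAt_of_rat hord.1 hord.2 v hpv
  have hgw : (Wd.baseChange F).HasGoodReductionAt w :=
    hasGoodReductionAt_baseChange_of_hasGoodReductionAt Wd F v w hgv
  have huw : (Wd.baseChange F).HasUnitRootAt w :=
    hasUnitRootAt_baseChange_of_hasGoodReductionAt Wd F p hpv hwv hgv huv
  -- `W_F ≅ Wd_F`: over `F` the twist parameter is a square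
  set gF : F := ⟨g, IntermediateField.mem_adjoin_simple_self ℚ g⟩ with hgF
  have hgF2 : (algebraMap ℚ F) d = 1 * gF ^ 2 := by
    apply (algebraMap F (CyclotomicField p ℚ)).injective
    rw [one_mul, map_pow, ← IsScalarTower.algebraMap_apply]
    change algebraMap ℚ (CyclotomicField p ℚ) d = g ^ 2
    rw [hg, hd, map_mul, map_pow, map_neg, map_one, map_natCast]
  have hgF0 : gF ≠ 0 := by
    intro h0
    have : (algebraMap ℚ F) d = 0 := by rw [hgF2, h0]; simp
    rw [map_eq_zero] at this
    exact (mul_ne_zero (pow_ne_zero _ (by norm_num)) (by exact_mod_cast hp.out.ne_zero)) this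
  have htw : (W.quadraticTwist d).baseChange F = (W.baseChange F).quadraticTwist (1 * gF ^ 2) := by
    rw [← hgF2]
    exact map_quadraticTwist W (algebraMap ℚ F) d
  haveI : NeZero (2 : F) := ⟨two_ne_zero⟩
  obtain ⟨C₁, hC₁⟩ := exists_variableChange_quadraticTwist_one (W.baseChange F)
  obtain ⟨C₂, hC₂⟩ := exists_variableChange_quadraticTwist_mul_sq (W.baseChange F) 1 gF hgF0
  have hWdF : Wd.baseChange F = (C₀.map (algebraMap ℚ F)) • (W.quadraticTwist d).baseChange F := by
    rw [← hWd, baseChange, baseChange, ← map_variableChange]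
  have hiso : (C₀.map (algebraMap ℚ F) * (C₂ * C₁)) • W.baseChange F = Wd.baseChange F := by
    rw [mul_smul, mul_smul, hC₁, hC₂, ← htw, hWdF]
  -- transport good reduction and unit root along the isomorphism
  have hgW : (W.baseChange F).HasGoodReductionAt w := by
    rw [← hasGoodReductionAt_smul_iff_holds w (W.baseChange F) (C₀.map (algebraMap ℚ F) * (C₂ * C₁)),
      hiso]
    exact hgw
  haveI : (W.baseChange F).IsElliptic := by rw [baseChange]; infer_instance
  refine ⟨hgW, ?_⟩
  rw [← hasUnitRootAt_smul_iff (W.baseChange F) (C₀.map (algebraMap ℚ F) * (C₂ * C₁)) w hgW, hiso]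
  exact huw

/-- **X3 ∩ (defect 2, twist good ordinary) ⊆ X3♯(G-ord)**: an Eisenstein additive prime `p ≠ 2`
whose twist `E^{(p*)}` is good ordinary at `p` is an X3♯(G-ord) pair. -/
theorem classX3Gord_of_goodOrd_quadraticTwist (hp2 : p ≠ 2) (hX : ClassX3 W p)
    (Wd : WeierstrassCurve ℚ) [Wd.IsElliptic] [Wd.IsGloballyMinimal] (C₀ : VariableChange ℚ)
    (hWd : C₀ • W.quadraticTwist ((-1 : ℚ) ^ (p / 2) * p) = Wd) (hord : GoodOrd Wd p) :
    ClassX3Gord W p :=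
  ⟨hX, typeGOrd_of_goodOrd_quadraticTwist W p hp2 Wd C₀ hWd hord⟩

/-- **X4 ∩ (defect 2, twist good ordinary) ⊆ X4♯(G-ord)**: an odd additive prime with irreducible
`E[p]` whose twist `E^{(p*)}` is good ordinary at `p` is an X4♯(G-ord) pair. -/
theorem classX4Gord_of_goodOrd_quadraticTwist (hX : ClassX4 W p)
    (Wd : WeierstrassCurve ℚ) [Wd.IsElliptic] [Wd.IsGloballyMinimal] (C₀ : VariableChange ℚ)
    (hWd : C₀ • W.quadraticTwist ((-1 : ℚ) ^ (p / 2) * p) = Wd) (hord : GoodOrd Wd p) :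
    ClassX4Gord W p :=
  ⟨hX, typeGOrd_of_goodOrd_quadraticTwist W p hX.1 Wd C₀ hWd hord⟩

end Twist

end Summit.BirchSwinnertonDyer.Rank1Residual.Additive

end
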